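import Summits.KontsevichZagierPeriods.KontsevichZagierPeriods.Theorems.EllipticMomentKernel.Negative.VerticalBand
import Summits.KontsevichZagierPeriods.KontsevichZagierPeriods.Theorems.EllipticMomentKernel.Negative.DimEval
import Summits.KontsevichZagierPeriods.KontsevichZagierPeriods.Theorems.EllipticMomentKernel.Negative.ModelCurve

/-!
# `EllipticMomentKernel` (stmt-KontsevichZagierPeriods-10631), line `merge-first-single-hermite` —
# drefute gen 3: the LOAD-BEARING HYPOTHESES of the stub set, kernel-checked

Refuter seat `refuter-drefute-stmt-KontsevichZagierPeriods-10631-g3-0` (mode drefute, gen 3).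
Skeleton attacked: `Cruxes/EllipticMomentKernel/Lines/merge-first-single-hermite.lean`
(sha256 `b28aeeea…`, unchanged since gen 1; six `stub_*`). Generations 1–2 established that all
six stubs are THEOREMS AS TYPED (gen-2 certificate `Cruxes/EllipticMomentKernel/DrefuteG2LineClosed.lean`,
re-verified by this seat on the current tree: rc 0, 0 sorry, axioms `propext/Classical.choice/Quot.sound`,
and the six signatures are the skeleton's verbatim). What gen 1 left ON PAPER is the MUTATION
analysis — which hypotheses of each stub are load-bearing. This file makes it kernel-checked, on
honest objects and for the model parameter `(q₂, q₃) = (4, 0)` (`disc = 64`):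

* `stub_columnMove_false_without_hsi` — drop `hsi` (the integrand of the target `s`) and the stub
  is FALSE: `r = [D, 1]` (the honest generator `underGraphRep`, area of `D`, value `> 0` by
  `value_pos_of_gens₂`) against `s = [σ, 0]`;
* `stub_columnMove_false_without_hri` — drop `hri` (the integrand of the source `r`) and the stub
  is FALSE: `[D, 1]` and `[D, 0]` would both be congruent to `[σ, √f]`, hence to each other;
* `stub_numeratorValue_false_without_hE` — drop `hE : ∫_σ E/√f = 0` and the value bookkeeping is
  FALSE: `A = 0, E = 1, α = β = 0, s = [σ, 1/√f]` has value `J₀ > 0` (`J0_pos`, no rigidity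
  needed), not `∫_σ 0 + 0·J₀ + 0·J₁ = 0`;
* `stub_polynomialPart_false_without_vanishing` — drop `∫_σ A = 0` from part 2 and it is FALSE:
  `[σ, 1]` has value `vol σ = e₂ − e₃ > 0`, so it is no relation (soundness).

Complement (decoration, not load-bearing): `hΔ : 0 < disc` is droppable from EVERY stub (σ = ∅
regime, gen 1; cf. `ellipticMomentKernel_iff_withoutDisc`) and is literally unused in the gen-1
proof of `stub_mergeToCarrier`; `hrep` of `stub_mergeToCarrier` is a convenience (the sum carrier
could be built in place by `IsSemialgebraicFunOn.add_holds`). Everything here is over LANDED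
modules only (`Negative/VerticalBand`, `Negative/DimEval`, `Negative/ModelCurve`). [folklore]
-/

noncomputable section

open MeasureTheory Set
open scoped Polynomial

namespace Summit.KontsevichZagierPeriods.HermiteRigidity.EllipticMomentKernel.DrefuteG3

open Literature.NumberTheory.Transcendental
open Literature.NumberTheory.Transcendental.KZ
open Summit.KontsevichZagierPeriods.HermiteRigidity.EllipticMomentKernelNegative
open Literature.ModelTheory.ExponentialFields (IsSemialgebraic isSemialgebraic_setOf_eval_pos)
open MvPolynomial (aeval X C)

variable {q₂ q₃ : ℚ}

/-! ## §1 The oval: open, bounded, of positive finite measure; positive integrands -/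

/-- The oval `σ` is open. [folklore] -/
theorem isOpen_oval : IsOpen (oval q₂ q₃) := by
  have h1 : IsOpen {p : Fin 1 → ℝ | 0 < cubic q₂ q₃ (p 0)} :=
    isOpen_lt continuous_const (continuous_cubic.comp (continuous_apply 0))
  have h2 : IsOpen {p : Fin 1 → ℝ | ∃ t : ℝ, p 0 < t ∧ cubic q₂ q₃ t < 0} := by
    rw [Set.setOf_exists]
    exact isOpen_iUnion fun t => by
      by_cases hft : cubic q₂ q₃ t < 0
      · simpa [hft] using isOpen_lt (continuous_apply 0) continuous_const
      · simp [hft]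
  have : oval q₂ q₃ = {p | 0 < cubic q₂ q₃ (p 0)} ∩
      {p : Fin 1 → ℝ | ∃ t : ℝ, p 0 < t ∧ cubic q₂ q₃ t < 0} := by
    ext p; simp only [oval, mem_setOf_eq, mem_inter_iff]
  rw [this]
  exact h1.inter h2

/-- The oval lies in the compact box `[e₃, e₂]`. [folklore] -/
theorem oval_subset_Icc (h : 0 < disc q₂ q₃) :
    ∃ lo hi : Fin 1 → ℝ, oval q₂ q₃ ⊆ Icc lo hi := by
  obtain ⟨e₃, e₂, e₁, h3, h2a, h2b, h1, hf⟩ := exists_roots h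
  have h32 : e₃ < e₂ := by linarith
  have h21 : e₂ < e₁ := by linarith
  refine ⟨fun _ => e₃, fun _ => e₂, ?_⟩
  rw [oval_eq_of_roots h32 h21 hf]
  intro p hp
  rw [mem_Icc, Pi.le_def, Pi.le_def]
  exact ⟨fun i => by fin_cases i; exact hp.1.le, fun i => by fin_cases i; exact hp.2.le⟩

/-- The oval has positive Lebesgue measure (open and non-empty). [folklore] -/
theorem volume_oval_pos (h : 0 < disc q₂ q₃) : 0 < volume (oval q₂ q₃) :=
  isOpen_oval.measure_pos volume ⟨_, neg_sqrt_mem_oval h⟩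

/-- A positive integrable function has positive integral over the oval. [folklore] -/
theorem setIntegral_oval_pos (h : 0 < disc q₂ q₃) {g : (Fin 1 → ℝ) → ℝ}
    (hg : IntegrableOn g (oval q₂ q₃)) (hpos : ∀ p ∈ oval q₂ q₃, 0 < g p) :
    0 < ∫ p in oval q₂ q₃, g p := by
  have hmeas : MeasurableSet (oval q₂ q₃) := isOpen_oval.measurableSet
  have hnn : 0 ≤ᵐ[volume.restrict (oval q₂ q₃)] g :=
    ae_restrict_of_forall_mem hmeas fun p hp => (hpos p hp).le
  rw [setIntegral_pos_iff_support_of_nonneg_ae hnn hg]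
  have hsub : oval q₂ q₃ ⊆ Function.support g ∩ oval q₂ q₃ := fun p hp =>
    ⟨Function.mem_support.2 (hpos p hp).ne', hp⟩
  exact (volume_oval_pos h).trans_le (measure_mono hsub)

/-- **`J₀ > 0` for every admissible parameter** (no rigidity needed). [folklore] -/
theorem J0_pos (h : 0 < disc q₂ q₃) : 0 < J0 q₂ q₃ := by
  unfold J0
  refine setIntegral_oval_pos h ?_ fun p hp => ?_
  · simpa using integrableOn_genIntegrandQ_oval h 0
  · exact one_div_pos.2 (Real.sqrt_pos.2 hp.1)

/-- Soundness in the two-representation form: congruent representations have equal values.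
[cite: KontsevichZagier2001, §1.2] -/
theorem value_eq_of_sub_mem_relations {n m : ℕ} {r : IntegralRep n} {s : IntegralRep m}
    (h : KZ.of r - KZ.of s ∈ KZ.relations) : r.value = s.value := by
  have := relations_le_ker_eval_holds h
  rwa [AddMonoidHom.mem_ker, map_sub, eval_of, eval_of, sub_eq_zero] at this

/-! ## §2 Honest representations used as witnesses -/

/-- `[σ, 0]`. [folklore] -/
def zeroOvalRep (h : 0 < disc q₂ q₃) : IntegralRep 1 where
  domain := oval q₂ q₃
  integrand := fun _ => 0
  isSemialgebraic_domain := isSemialgebraic_oval h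
  isSemialgebraicFunOn_integrand :=
    (isSemialgebraicFunOn_aeval (isSemialgebraic_oval h) (0 : MvPolynomial (Fin 1) ℚ)).congr
      fun _ _ => by simp
  integrableOn := integrableOn_zero

/-- `[σ, 1]` (the length `e₂ − e₃` of the oval). [folklore] -/
def oneOvalRep (h : 0 < disc q₂ q₃) : IntegralRep 1 where
  domain := oval q₂ q₃
  integrand := fun _ => 1
  isSemialgebraic_domain := isSemialgebraic_oval h
  isSemialgebraicFunOn_integrand :=
    (isSemialgebraicFunOn_aeval (isSemialgebraic_oval h) (1 : MvPolynomial (Fin 1) ℚ)).congr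
      fun _ _ => by simp
  integrableOn := by
    obtain ⟨lo, hi, hsub⟩ := oval_subset_Icc h
    have hc : Continuous fun _ : Fin 1 → ℝ => (1 : ℝ) := continuous_const
    exact (hc.continuousOn.integrableOn_compact isCompact_Icc).mono_set hsub

/-- `value [σ, 0] = 0`. [folklore] -/
theorem value_zeroOvalRep (h : 0 < disc q₂ q₃) : (zeroOvalRep h).value = 0 := by
  simp [IntegralRep.value, zeroOvalRep]

/-- `value [σ, 1] > 0`. [folklore] -/
theorem value_oneOvalRep_pos (h : 0 < disc q₂ q₃) : 0 < (oneOvalRep h).value :=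
  setIntegral_oval_pos h (oneOvalRep h).integrableOn fun _ _ => one_pos

/-- `D = vBand ∩ {0 < y} ∩ {y² < f(x)}` (the open region inside the closed band). [folklore] -/
theorem underGraph_eq_inter (q₂ q₃ : ℚ) :
    underGraph q₂ q₃ = vBand q₂ q₃ ∩ ({z | 0 < z 1} ∩ {z | z 1 ^ 2 < cubic q₂ q₃ (z 0)}) := by
  ext z
  simp only [underGraph, oval, mem_vBand_iff, mem_inter_iff, mem_setOf_eq, init_apply_zero]
  constructor
  · rintro ⟨hσ, h0, hlt⟩
    exact ⟨⟨hσ, h0.le, ((Real.lt_sqrt h0.le).2 hlt).le⟩, h0, hlt⟩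
  · rintro ⟨⟨hσ, -, -⟩, h0, hlt⟩
    exact ⟨hσ, h0, hlt⟩

/-- `D ⊆ vBand`. [folklore] -/
theorem underGraph_subset_vBand (q₂ q₃ : ℚ) : underGraph q₂ q₃ ⊆ vBand q₂ q₃ := by
  rw [underGraph_eq_inter]; exact inter_subset_left

/-- **`D` is `ℚ`-semialgebraic** (quantifier-free over the landed `isSemialgebraic_vBand`).
[folklore] -/
theorem isSemialgebraic_underGraph (h : 0 < disc q₂ q₃) :
    IsSemialgebraic ℚ (underGraph q₂ q₃) := by
  have h2 : IsSemialgebraic ℚ {z : Fin 2 → ℝ | 0 < z 1} := by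
    simpa using isSemialgebraic_setOf_eval_pos (k := ℚ) (R := ℝ) (X 1 : MvPolynomial (Fin 2) ℚ)
  have h3 : IsSemialgebraic ℚ {z : Fin 2 → ℝ | z 1 ^ 2 < cubic q₂ q₃ (z 0)} := by
    have h3' := isSemialgebraic_setOf_eval_pos (k := ℚ) (R := ℝ)
      (cubicPoly₂ q₂ q₃ - X 1 ^ 2 : MvPolynomial (Fin 2) ℚ)
    convert h3' using 1
    ext z
    simp only [mem_setOf_eq, map_sub, map_pow, MvPolynomial.aeval_X, aeval_cubicPoly₂]
    constructor <;> intro hz <;> linarith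
  rw [underGraph_eq_inter]
  exact (isSemialgebraic_vBand h).inter (h2.inter h3)

/-- **The honest 2-dimensional generator `[D, x^a y^b]`** as an `IntegralRep 2`.
[cite: KontsevichZagier2001, §1.1] -/
def underGraphRep (h : 0 < disc q₂ q₃) (a b : ℕ) : IntegralRep 2 where
  domain := underGraph q₂ q₃
  integrand := fun p => p 0 ^ a * p 1 ^ b
  isSemialgebraic_domain := isSemialgebraic_underGraph h
  isSemialgebraicFunOn_integrand :=
    (isSemialgebraicFunOn_aeval (isSemialgebraic_underGraph h)
      (X 0 ^ a * X 1 ^ b : MvPolynomial (Fin 2) ℚ)).congr fun p _ => by simp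
  integrableOn := (integrableOn_moment_vBand h a b).mono_set (underGraph_subset_vBand q₂ q₃)

/-- `[D, 0]`. [folklore] -/
def zeroUnderGraphRep (h : 0 < disc q₂ q₃) : IntegralRep 2 where
  domain := underGraph q₂ q₃
  integrand := fun _ => 0
  isSemialgebraic_domain := isSemialgebraic_underGraph h
  isSemialgebraicFunOn_integrand :=
    (isSemialgebraicFunOn_aeval (isSemialgebraic_underGraph h) (0 : MvPolynomial (Fin 2) ℚ)).congr
      fun _ _ => by simp
  integrableOn := integrableOn_zero

/-- `value [D, 0] = 0`. [folklore] -/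
theorem value_zeroUnderGraphRep (h : 0 < disc q₂ q₃) : (zeroUnderGraphRep h).value = 0 := by
  simp [IntegralRep.value, zeroUnderGraphRep]

/-- `[D, x^a y^b] ∈ gens₂` — the moment half of the sector is inhabited. [folklore] -/
theorem of_underGraphRep_mem_gens₂ (h : 0 < disc q₂ q₃) (a b : ℕ) :
    KZ.of (underGraphRep h a b) ∈ gens₂ q₂ q₃ :=
  ⟨underGraphRep h a b, a, b, rfl, fun _ _ => rfl, rfl⟩

/-- `value [D, x^a y^b] > 0` for `a` even (landed `value_pos_of_gens₂` on the honest object).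
[folklore] -/
theorem value_underGraphRep_pos (h : 0 < disc q₂ q₃) {a : ℕ} (ha : Even a) (b : ℕ) :
    0 < (underGraphRep h a b).value :=
  value_pos_of_gens₂ h ha rfl fun _ _ => rfl

/-- The model parameter is admissible: `disc 4 0 = 64 > 0`. [folklore] -/
theorem disc_pos_model : 0 < disc 4 0 := by
  rw [disc_four_zero]; norm_num

/-! ## §3 The mutations: each dropped hypothesis is load-bearing -/

/-- **`stub_columnMove` without `hsi` is false**: with the integrand of `s` unconstrained, take
`r = [D, 1]` (value `> 0`) and `s = [σ, 0]` on the model curve; a relation would force equal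
values. So any proof of `stub_columnMove` uses `hsi`. [folklore] -/
theorem stub_columnMove_false_without_hsi :
    ¬ ∀ (q₂ q₃ : ℚ), 0 < disc q₂ q₃ → ∀ (a b : ℕ) (r : IntegralRep 2),
        r.domain = underGraph q₂ q₃ →
        EqOn r.integrand (fun p => p 0 ^ a * p 1 ^ b) (underGraph q₂ q₃) →
        ∀ s : IntegralRep 1, s.domain = oval q₂ q₃ → KZ.of r - KZ.of s ∈ KZ.relations := by
  intro H
  have h := disc_pos_model
  have hmem := H 4 0 h 0 0 (underGraphRep h 0 0) rfl (fun _ _ => rfl) (zeroOvalRep h) rfl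
  have hval := value_eq_of_sub_mem_relations hmem
  rw [value_zeroOvalRep] at hval
  exact (value_underGraphRep_pos h Even.zero 0).ne' hval

/-- **`stub_columnMove` without `hri` is false**: with the integrand of `r` unconstrained, both
`[D, 1]` and `[D, 0]` would be congruent to the honest target `[σ, √f]` (`vBaseRep`), hence to
each other, forcing `value [D, 1] = 0`. So any proof of `stub_columnMove` uses `hri`. [folklore] -/
theorem stub_columnMove_false_without_hri :
    ¬ ∀ (q₂ q₃ : ℚ), 0 < disc q₂ q₃ → ∀ (a b : ℕ) (r : IntegralRep 2),
        r.domain = underGraph q₂ q₃ → ∀ s : IntegralRep 1, s.domain = oval q₂ q₃ →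
        EqOn s.integrand
          (fun p => p 0 ^ a * Real.sqrt (cubic q₂ q₃ (p 0)) ^ (b + 1) / ((b : ℝ) + 1))
          (oval q₂ q₃) →
        KZ.of r - KZ.of s ∈ KZ.relations := by
  intro H
  have h := disc_pos_model
  have h₁ := H 4 0 h 0 0 (underGraphRep h 0 0) rfl (vBaseRep h 0 0) rfl (fun _ _ => rfl)
  have h₀ := H 4 0 h 0 0 (zeroUnderGraphRep h) rfl (vBaseRep h 0 0) rfl (fun _ _ => rfl)
  have hmem : KZ.of (underGraphRep h 0 0) - KZ.of (zeroUnderGraphRep h) ∈ KZ.relations := by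
    have : KZ.of (underGraphRep h 0 0) - KZ.of (zeroUnderGraphRep h) =
        (KZ.of (underGraphRep h 0 0) - KZ.of (vBaseRep h 0 0)) -
          (KZ.of (zeroUnderGraphRep h) - KZ.of (vBaseRep h 0 0)) := by abel
    rw [this]
    exact KZ.relations.sub_mem h₁ h₀
  have hval := value_eq_of_sub_mem_relations hmem
  rw [value_zeroUnderGraphRep] at hval
  exact (value_underGraphRep_pos h Even.zero 0).ne' hval

/-- **`stub_numeratorValue` without `hE` is false**: `A = 0`, `E = 1`, `α = β = 0`,
`s = [σ, 1/√f]` (`genRepQ h 0`) has value `J₀ > 0`, not `∫_σ 0 + 0·J₀ + 0·J₁ = 0`. So the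
exactness hypothesis `hE` is load-bearing (and, with `disc > 0`, it is the ONLY thing `hE`
contributes: integrability of `E/√f` on `σ` holds for every `E`). [folklore] -/
theorem stub_numeratorValue_false_without_hE :
    ¬ ∀ (q₂ q₃ : ℚ), 0 < disc q₂ q₃ → ∀ (A E : ℚ[X]) (α β : ℚ) (s : IntegralRep 1),
        s.domain = oval q₂ q₃ →
        EqOn s.integrand (fun p => (Polynomial.aeval (p 0) A : ℝ) +
          (Polynomial.aeval (p 0) (Polynomial.C α + Polynomial.C β * Polynomial.X + E) : ℝ) /
            Real.sqrt (cubic q₂ q₃ (p 0))) (oval q₂ q₃) →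
        s.value = (∫ p in oval q₂ q₃, (Polynomial.aeval (p 0) A : ℝ)) +
          (α : ℝ) * J0 q₂ q₃ + (β : ℝ) * J1 q₂ q₃ := by
  intro H
  have h := disc_pos_model
  have hs : EqOn (genRepQ h 0).integrand (fun p => (Polynomial.aeval (p 0) (0 : ℚ[X]) : ℝ) +
      (Polynomial.aeval (p 0) (Polynomial.C (0 : ℚ) + Polynomial.C (0 : ℚ) * Polynomial.X + 1) : ℝ) /
        Real.sqrt (cubic 4 0 (p 0))) (oval 4 0) := fun p _ => by
    simp [genRepQ]
  have hval := H 4 0 h 0 1 0 0 (genRepQ h 0) rfl hs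
  rw [value_genRepQ_zero] at hval
  simp only [map_zero, Rat.cast_zero, zero_mul, add_zero, integral_zero] at hval
  exact (J0_pos h).ne' hval

/-- **`stub_polynomialPart`.2 without `∫_σ A = 0` is false**: `A = 1`, `s = [σ, 1]` has value
`vol σ > 0`, so `[σ, 1]` is no relation (soundness). So the vanishing hypothesis is load-bearing —
it is exactly the legality condition of the Newton–Leibniz move onto `[pt, 0]`. [folklore] -/
theorem stub_polynomialPart_false_without_vanishing :
    ¬ ∀ (q₂ q₃ : ℚ), 0 < disc q₂ q₃ → ∀ (A : ℚ[X]) (s : IntegralRep 1),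
        s.domain = oval q₂ q₃ →
        EqOn s.integrand (fun p => (Polynomial.aeval (p 0) A : ℝ)) (oval q₂ q₃) →
        KZ.of s ∈ KZ.relations := by
  intro H
  have h := disc_pos_model
  have hmem := H 4 0 h 1 (oneOvalRep h) rfl (fun p _ => by simp [oneOvalRep])
  have h0 : (oneOvalRep h).value = 0 := by
    have := relations_le_ker_eval_holds hmem
    rwa [AddMonoidHom.mem_ker, eval_of] at this
  exact (value_oneOvalRep_pos h).ne' h0

end Summit.KontsevichZagierPeriods.HermiteRigidity.EllipticMomentKernel.DrefuteG3
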